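import Literature.AlgebraicGeometry.HodgeTheory.RegularFormRealizationNaturality
import Literature.AlgebraicGeometry.HodgeTheory.RegularFormRealizationDegreeZero
import Literature.AlgebraicGeometry.Motives.AffineAlgebraicDeRhamAffineSpaceProofs
import Literature.NumberTheory.Transcendental.AnalytificationAffineSpaceProofs
import Literature.NumberTheory.Transcendental.DolbeaultHolomorphicFunctions
import Literature.Geometry.Kaehler.StarShapedLocalPoincare
import HarnessLib

/-!
# Grothendieck's comparison theorem (Thm 1′) for affine space; model independence of the comparison

[topic AlgebraicGeometry/HodgeTheory]

Sequel of `RegularFormRealization` (Grothendieck's comparison map (5)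
`deRhamComparison A x hI p : H^p(Γ(V(I), Ω•)) → H^p_dR(Y^an; ℂ)` and the holomorphic image of
regular forms `regularFormRealize`, [Grothendieck1966, p. 96 (4)–(5)]), of
`RegularFormRealizationDegreeZero` (Theorem 1′ in degree `0`) and of
`RegularFormRealizationNaturality` (naturality of (5) along `ℂ`-morphisms, programme node P2-nat
of the `lit-hodgefound` lane). The typed obligation that these files serve is the hypothesis
`(hcmp)` of `chartConjugation_canonical_of_deRhamComparison`
(`ConjRealizeKernelOfDeRhamComparison`): *for every smooth affine `Y`, every analytic model `A` of
`Y` and every degree `k` there are generating coordinates `x` with the holomorphic image of regular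
`(k+1)`-forms on `V(ker φ_x)` faithful and (5) bijective in degree `k`* — Grothendieck's
**Theorem 1′** [Grothendieck1966, p. 96: *"The homomorphism (5) is an isomorphism"*] together
with the faithfulness of `Ω•_Y → Ω•_{Y^an}`. The tree had instances of it in degree `0` and above
the real dimension only. This file proves:

* **§1 Functoriality of `h ↦ h^an`** (`AnalyticModel.anMap_id`, `anMap_comp_anMap`,
  `anMap_anMap_id`; Serre, GAGA §2 n°5) and **§2 model independence**: for two analytic models
  `A`, `B` of the same smooth affine `Y` (on possibly different model spaces) the holomorphic images
  of a regular form correspond under the biholomorphism `𝟙^an : A → B`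
  (`regularFormRealize_pullback_anMap_id`, from P2-nat with `h = 𝟙`, `F = T`), so that
  faithfulness of `regularFormRealize`, and injectivity / surjectivity / bijectivity of
  `deRhamComparison`, hold for `A` as soon as they hold for `B`
  (`regularFormRealize_injective_of_model`, `deRhamComparison_{injective,surjective,bijective}_of_model`);
  and `H^p_dR(A; ℂ) ≃ H^p_dR(B; ℂ)` (`AnalyticModel.complexDeRhamCohomologyEquiv`). Hence `(hcmp)`
  may be verified on any ONE preferred model of `Y`.
* **§3 Pointwise faithfulness**: if at `z ∈ Y^an` the coordinate differentials `(dx_l^an)_z`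
  admit dual tangent vectors, then a polynomial `p`-form whose holomorphic image vanishes at `z`
  has all its coefficients `(φ_x α(e_J))^an`, `J` increasing, vanishing at `z`
  (`regularFun_coeff_eq_zero_of_polyFormRealize_apply_eq_zero`; the decomposition
  `α = Σ_J α(e_J) dT_J`, `(dT_J)^an = dx_J^an`, and the linear independence of iterated wedges of a
  dual family, `ContinuousAlternatingMap.linearIndependent_iterWedge_of_dual`) — Serre's "algebraic
  forms inject into analytic forms" [SerreGAGA1956, §2 n°6 Prop. 3 Cor. 2] read at one point, on the
  `PolyForm` carrier.
* **§4 The Poincaré lemma for the model space**: `H^{k+1}_dR(E; ℂ) = 0` for a finite-dimensional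
  complex normed space `E` regarded as a manifold charted on itself
  (`subsingleton_complexDeRhamCohomology_modelSpace_succ`; Lee, Thm. 17.14, through the tree's
  `localClosedForms_chartSet_le_localExactForms`).
* **§5 The standard analytic model of `𝔸^m_ℂ`** (`AnalyticModel.affineSpace m`: carrier `ℂ^m`,
  comparison map `AlgPoints.affinePoint ℂ`, [SerreGAGA1956, §2 n°5 Lemme 1, Prop. 2] = the tree's
  `exists_isAnalytification_affineSpace_holds`), the coordinates `affineSpaceCoord m i = Tᵢ`, for which
  `φ_x : ℂ[T] → Γ(𝔸^m, 𝒪)` is bijective (`coordPresentation_affineSpaceCoord_bijective`,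
  `ker_coordPresentation_affineSpaceCoord`), and `(φ_x f)^an = f` as a function on `ℂ^m`.
* **§6 Theorem 1′ for affine space**: for EVERY analytic model `A` of `𝔸^m_ℂ`, the holomorphic
  image of regular `p`-forms along the coordinates `T` is faithful in every degree
  (`regularFormRealize_affineSpace_injective`) and Grothendieck's comparison map is bijective in
  every degree (`deRhamComparison_affineSpace_bijective`): in degree `0` this is
  `deRhamComparison_bijective_degree_zero`; in degree `k + 1` both sides vanish —
  `H^{k+1}_dR(𝔸^m/ℂ) = 0` [Hartshorne1975, Ch. II §7 p. 53] (`subsingleton_deRhamCohomology_bot_succ`)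
  and `H^{k+1}_dR(ℂ^m; ℂ) = 0` (§4), transported to `A` by §2. `hcmp_affineSpace` is the `(hcmp)`
  clause verbatim for `Y = 𝔸^m`, and `exists_realize_eq_affineSpace` the conclusion of (G)
  (`grothendieck_comparison_realize_surjective`) for affine space.

Everything is proved; the only definitions are the standard model `AnalyticModel.affineSpace`, its
coordinates `affineSpaceCoord`, and the equivalence `AnalyticModel.complexDeRhamCohomologyEquiv`
(with bodies); no named facts are introduced (net debt 0).

## References

* [Grothendieck1966] A. Grothendieck, *On the de Rham cohomology of algebraic varieties*, Publ.
  Math. IHÉS 29 (1966) 95–103: p. 96 (4)–(5), Thm 1′ ("The homomorphism (5) is an isomorphism").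
* [Hartshorne1975] R. Hartshorne, *On the De Rham cohomology of algebraic varieties*, Publ. Math.
  IHÉS 45 (1975), Ch. II §7 p. 53 (`H⁰(𝔸ⁿ) = k`, all other groups zero), Prop. (7.1).
* [SerreGAGA1956] J.-P. Serre, *Géométrie algébrique et géométrie analytique*, Ann. Inst. Fourier 6
  (1956), §2 n°5 (Lemme 1, Prop. 2: `ℂⁿ` is the analytification of affine space; fonctorialité de
  `X ↦ X^h`), n°6 Prop. 3 Cor. 2.
* [LeeSmoothManifolds2013] J. M. Lee, *Introduction to Smooth Manifolds*, 2nd ed., Thm. 17.14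
  (Poincaré lemma for star-shaped open subsets of `ℝⁿ`).
* [Warner1983] F. Warner, *Foundations of differentiable manifolds and Lie groups*, 2.22–2.23
  (functoriality of `f^*`).
-/

noncomputable section

universe u

open scoped Manifold ContDiff
open CategoryTheory AlgebraicGeometry MvPolynomial Set
open Literature.NumberTheory.Transcendental Literature.Geometry.Kaehler
open Literature.AlgebraicGeometry.Motives Literature.AlgebraicGeometry.Motives.AffineDeRham

namespace Literature.AlgebraicGeometry.HodgeTheory

section HodgeTheory

/-! ### §1 Functoriality of the analytified morphism `h ↦ h^an` -/

namespace AnalyticModel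

variable {E₁ : Type} [NormedAddCommGroup E₁] [NormedSpace ℂ E₁] [FiniteDimensional ℂ E₁]
  {E₂ : Type} [NormedAddCommGroup E₂] [NormedSpace ℂ E₂] [FiniteDimensional ℂ E₂]
  {E₃ : Type} [NormedAddCommGroup E₃] [NormedSpace ℂ E₃] [FiniteDimensional ℂ E₃]
  {m₁ m₂ m₃ : ℕ} {Y₁ Y₂ Y₃ : Motives.SchemeOver ℂ}

/-- **`(𝟙_Y)^an = id`** between an analytic model and itself (`ψ⁻¹ ∘ 𝟙(ℂ) ∘ ψ = id`).
[cite: SerreGAGA1956, §2 n°5] -/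
theorem anMap_id (A : AnalyticModel E₁ m₁ Y₁) : A.anMap A (𝟙 Y₁) = id := by
  funext z
  change A.isAnalytification.homeomorph.symm
    (Motives.AlgPoints.map (𝟙 Y₁) (A.isAnalytification.homeomorph z)) = z
  rw [Motives.AlgPoints.map_id_apply]
  exact A.isAnalytification.homeomorph.symm_apply_apply z

/-- **`g^an ∘ f^an = (f ≫ g)^an`**: the analytified morphisms compose (`X ↦ X^h` is a functor).
[cite: SerreGAGA1956, §2 n°5] -/
theorem anMap_comp_anMap (A₁ : AnalyticModel E₁ m₁ Y₁) (A₂ : AnalyticModel E₂ m₂ Y₂)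
    (A₃ : AnalyticModel E₃ m₃ Y₃) (f : Y₁ ⟶ Y₂) (g : Y₂ ⟶ Y₃) :
    A₂.anMap A₃ g ∘ A₁.anMap A₂ f = A₁.anMap A₃ (f ≫ g) := by
  funext z
  have h2 : A₂.toComplexPoints (A₂.isAnalytification.homeomorph.symm
      (Motives.AlgPoints.map f (A₁.toComplexPoints z))) =
      Motives.AlgPoints.map f (A₁.toComplexPoints z) :=
    A₂.isAnalytification.homeomorph.apply_symm_apply _
  simp only [anMap, Function.comp_apply]
  rw [h2, Motives.AlgPoints.map_comp_apply]

/-- Two analytic models `A`, `B` of one `Y`: **`𝟙^an : B → A` is a left inverse of `𝟙^an : A → B`**.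
[cite: SerreGAGA1956, §2 n°5] -/
theorem anMap_anMap_id (A : AnalyticModel E₁ m₁ Y₁) (B : AnalyticModel E₂ m₂ Y₁) (z : A.carrier) :
    B.anMap A (𝟙 Y₁) (A.anMap B (𝟙 Y₁) z) = z := by
  have h := congrFun (A.anMap_comp_anMap B A (𝟙 Y₁) (𝟙 Y₁)) z
  rw [Function.comp_apply, Category.comp_id, anMap_id] at h
  exact h

/-- `𝟙^an : B → A` composed with `𝟙^an : A → B` is the identity. [cite: SerreGAGA1956, §2 n°5] -/
theorem anMap_id_comp_anMap_id (A : AnalyticModel E₁ m₁ Y₁) (B : AnalyticModel E₂ m₂ Y₁) :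
    B.anMap A (𝟙 Y₁) ∘ A.anMap B (𝟙 Y₁) = id :=
  funext (A.anMap_anMap_id B)

end AnalyticModel

/-! ### §2 Model independence of the holomorphic image and of the comparison map -/

section ModelIndependence

variable {E₁ : Type} [NormedAddCommGroup E₁] [NormedSpace ℂ E₁] [FiniteDimensional ℂ E₁]
  {E₂ : Type} [NormedAddCommGroup E₂] [NormedSpace ℂ E₂] [FiniteDimensional ℂ E₂]
  {m : ℕ} {Y : Motives.SchemeOver ℂ} {N : ℕ}

/-- The identity substitution `T ↦ T` maps every ideal into itself (`bind₁ T = id`; private helper). [folklore] -/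
private theorem ideal_map_bind₁_X_le (I : Ideal (MvPolynomial (Fin N) ℂ)) :
    I.map (bind₁ (X : Fin N → MvPolynomial (Fin N) ℂ) :
      MvPolynomial (Fin N) ℂ →ₐ[ℂ] MvPolynomial (Fin N) ℂ) ≤ I := by
  rw [Ideal.map_le_iff_le_comap]
  intro f hf
  rw [Ideal.mem_comap]
  have h : (bind₁ (X : Fin N → MvPolynomial (Fin N) ℂ) :
      MvPolynomial (Fin N) ℂ →ₐ[ℂ] MvPolynomial (Fin N) ℂ) f = f := by
    rw [bind₁_X_left, AlgHom.id_apply]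
  rw [h]
  exact hf

/-- The identity `𝟙 Y` has the identity lift `Tⱼ ↦ Tⱼ` on any coordinates: `(𝟙)♯ xⱼ = φ_x(Tⱼ)`.
[cite: Hartshorne1977, II §3] -/
theorem appTop_id_eq_coordPresentation_X (x : Fin N → Γ(Y.left, ⊤)) (j : Fin N) :
    (𝟙 Y : Y ⟶ Y).left.appTop (x j) = coordPresentation Y x (X j) := by
  rw [coordPresentation_X, Over.id_left, Scheme.Hom.id_appTop, CommRingCat.id_apply]

variable [IsAffine Y.left] [SmoothOfRelativeDimension m Y.hom]
  (A : AnalyticModel E₁ m Y) (B : AnalyticModel E₂ m Y) (x : Fin N → Γ(Y.left, ⊤))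

/-- **The holomorphic images of a polynomial form on two models correspond under `𝟙^an`**:
`(𝟙^an)^* (α^an_B) = α^an_A` (P2-nat `polyFormRealize_pullback_anMap` with `h = 𝟙`, `F = T`,
and `T^* α = α`). [cite: Grothendieck1966, (5)] -/
theorem polyFormRealize_pullback_anMap_id (p : ℕ) (α : PolyForm ℂ N p) :
    (polyFormRealize B x p α).pullback 𝓘(ℝ, E₁) (A.anMap B (𝟙 Y)) = polyFormRealize A x p α := by
  rw [polyFormRealize_pullback_anMap A B (𝟙 Y) (appTop_id_eq_coordPresentation_X x),
    PolyForm.comap_X]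

/-- **The holomorphic images of a regular form on two models correspond under `𝟙^an`**:
`(𝟙^an)^* (r^an_B) = r^an_A` for every regular `p`-form `r` on `V(I)`, `I ⊆ ker φ_x`.
[cite: Grothendieck1966, (5)] -/
theorem regularFormRealize_pullback_anMap_id {I : Ideal (MvPolynomial (Fin N) ℂ)}
    (hI : I ≤ RingHom.ker (coordPresentation Y x)) (p : ℕ) (r : RegularForm I p) :
    (regularFormRealize B x hI p r).pullback 𝓘(ℝ, E₁) (A.anMap B (𝟙 Y)) =
      regularFormRealize A x hI p r := by
  rw [regularFormRealize_pullback_anMap A B (𝟙 Y) (appTop_id_eq_coordPresentation_X x) hI hI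
    (ideal_map_bind₁_X_le I) p r, RegularForm.comap_X_eq_id (ideal_map_bind₁_X_le I) p,
    LinearMap.id_apply]

/-- **The comparison maps of two models correspond under `(𝟙^an)^*`**:
`(𝟙^an)^* (deRhamComparison_B c) = deRhamComparison_A c`. [cite: Grothendieck1966, (5)] -/
theorem map_anMap_id_deRhamComparison {I : Ideal (MvPolynomial (Fin N) ℂ)}
    (hI : I ≤ RingHom.ker (coordPresentation Y x)) (p : ℕ) (c : DeRhamCohomology I p) :
    complexDeRhamCohomology.map E₁ (A.contMDiff_anMap B (𝟙 Y)) p (deRhamComparison B x hI p c) =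
      deRhamComparison A x hI p c := by
  rw [deRhamComparison_map_eq A B (𝟙 Y) (appTop_id_eq_coordPresentation_X x) hI hI
    (ideal_map_bind₁_X_le I) p c, DeRhamCohomology.comap_X_eq_id (ideal_map_bind₁_X_le I) p,
    LinearMap.id_apply]

omit [IsAffine Y.left] in
/-- **`(𝟙^an_{A→B})^* ∘ (𝟙^an_{B→A})^* = id` on `H^p_dR(A; ℂ)`** (functoriality of `f^*` on de Rham
cohomology, Bott–Tu §I.2, and `𝟙^an_{B→A} ∘ 𝟙^an_{A→B} = id`). [cite: BottTu1982Forms, §I.2] -/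
theorem map_anMap_id_map_anMap_id (p : ℕ) (c : complexDeRhamCohomology E₁ A.carrier p) :
    complexDeRhamCohomology.map E₁ (A.contMDiff_anMap B (𝟙 Y)) p
      (complexDeRhamCohomology.map E₂ (B.contMDiff_anMap A (𝟙 Y)) p c) = c := by
  obtain ⟨α, rfl⟩ := complexDeRhamCohomology.mk_surjective c
  rw [complexDeRhamCohomology.map_mk, complexDeRhamCohomology.map_mk]
  congr 1
  refine Subtype.ext ?_
  change ((α : MForm 𝓘(ℝ, E₁) A.carrier ℂ p).pullback 𝓘(ℝ, E₂) (B.anMap A (𝟙 Y))).pullback 𝓘(ℝ, E₁)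
    (A.anMap B (𝟙 Y)) = (α : MForm 𝓘(ℝ, E₁) A.carrier ℂ p)
  rw [← MForm.pullback_comp ((B.contMDiff_anMap A (𝟙 Y)).mdifferentiable (by simp))
    ((A.contMDiff_anMap B (𝟙 Y)).mdifferentiable (by simp)), A.anMap_id_comp_anMap_id B,
    MForm.pullback_id]

omit [IsAffine Y.left] in
/-- **The complex de Rham cohomologies of two analytic models of `Y` are isomorphic** along
`(𝟙^an)^*` (uniqueness of the analytification up to biholomorphism, Serre GAGA §2 n°5, and
functoriality of `f^*`). [cite: SerreGAGA1956, §2 n°5] [cite: BottTu1982Forms, §I.2] -/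
def AnalyticModel.complexDeRhamCohomologyEquiv (p : ℕ) :
    complexDeRhamCohomology E₁ A.carrier p ≃ₗ[ℂ] complexDeRhamCohomology E₂ B.carrier p where
  toLinearMap := complexDeRhamCohomology.map E₂ (B.contMDiff_anMap A (𝟙 Y)) p
  invFun := complexDeRhamCohomology.map E₁ (A.contMDiff_anMap B (𝟙 Y)) p
  left_inv c := map_anMap_id_map_anMap_id A B p c
  right_inv c := map_anMap_id_map_anMap_id B A p c

omit [IsAffine Y.left] in
/-- `complexDeRhamCohomologyEquiv A B p` is `(𝟙^an_{B→A})^*` (definitional). [cite: BottTu1982Forms, §I.2] -/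
theorem AnalyticModel.complexDeRhamCohomologyEquiv_apply (p : ℕ)
    (c : complexDeRhamCohomology E₁ A.carrier p) :
    A.complexDeRhamCohomologyEquiv B p c =
      complexDeRhamCohomology.map E₂ (B.contMDiff_anMap A (𝟙 Y)) p c :=
  rfl

omit [IsAffine Y.left] in
/-- **`H^p_dR(A; ℂ) = 0` for one model of `Y` iff for every model.** [cite: SerreGAGA1956, §2 n°5] -/
theorem AnalyticModel.subsingleton_complexDeRhamCohomology_of_model (p : ℕ)
    [h : Subsingleton (complexDeRhamCohomology E₂ B.carrier p)] :
    Subsingleton (complexDeRhamCohomology E₁ A.carrier p) :=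
  (A.complexDeRhamCohomologyEquiv B p).toEquiv.subsingleton

/-- **Faithfulness of the holomorphic image is independent of the model**: if `r ↦ r^an_B` is
injective on regular `p`-forms on `V(I)` for one model `B`, it is injective for every model `A`
(`r^an_B = (𝟙^an)^* r^an_A`). [cite: Grothendieck1966, (5)] [cite: SerreGAGA1956, §2 n°5] -/
theorem regularFormRealize_injective_of_model {I : Ideal (MvPolynomial (Fin N) ℂ)}
    (hI : I ≤ RingHom.ker (coordPresentation Y x)) (p : ℕ)
    (hB : Function.Injective (regularFormRealize B x hI p)) :
    Function.Injective (regularFormRealize A x hI p) := by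
  refine (injective_iff_map_eq_zero _).2 fun r hr ↦ hB ?_
  rw [map_zero, ← regularFormRealize_pullback_anMap_id B A x hI p r, hr, MForm.pullback_zero]

/-- **Injectivity of the comparison map is independent of the model.** [cite: Grothendieck1966, Thm 1']
[cite: SerreGAGA1956, §2 n°5] -/
theorem deRhamComparison_injective_of_model {I : Ideal (MvPolynomial (Fin N) ℂ)}
    (hI : I ≤ RingHom.ker (coordPresentation Y x)) (p : ℕ)
    (hB : Function.Injective (deRhamComparison B x hI p)) :
    Function.Injective (deRhamComparison A x hI p) := by
  refine (injective_iff_map_eq_zero _).2 fun c hc ↦ hB ?_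
  rw [map_zero, ← map_anMap_id_deRhamComparison B A x hI p c, hc, map_zero]

/-- **Surjectivity of the comparison map is independent of the model.** [cite: Grothendieck1966, Thm 1']
[cite: SerreGAGA1956, §2 n°5] -/
theorem deRhamComparison_surjective_of_model {I : Ideal (MvPolynomial (Fin N) ℂ)}
    (hI : I ≤ RingHom.ker (coordPresentation Y x)) (p : ℕ)
    (hB : Function.Surjective (deRhamComparison B x hI p)) :
    Function.Surjective (deRhamComparison A x hI p) := by
  intro c
  obtain ⟨d, hd⟩ := hB (complexDeRhamCohomology.map E₂ (B.contMDiff_anMap A (𝟙 Y)) p c)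
  refine ⟨d, ?_⟩
  rw [← map_anMap_id_deRhamComparison A B x hI p d, hd, map_anMap_id_map_anMap_id A B p c]

/-- **Bijectivity of the comparison map (Theorem 1′) is independent of the model**: Grothendieck's
Theorem 1′ for `(Y, B, x, I, p)` implies it for `(Y, A, x, I, p)`, `A` any other analytic model of
`Y` on any model space. [cite: Grothendieck1966, Thm 1'] [cite: SerreGAGA1956, §2 n°5] -/
theorem deRhamComparison_bijective_of_model {I : Ideal (MvPolynomial (Fin N) ℂ)}
    (hI : I ≤ RingHom.ker (coordPresentation Y x)) (p : ℕ)
    (hB : Function.Bijective (deRhamComparison B x hI p)) :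
    Function.Bijective (deRhamComparison A x hI p) :=
  ⟨deRhamComparison_injective_of_model A B x hI p hB.1,
    deRhamComparison_surjective_of_model A B x hI p hB.2⟩

end ModelIndependence

/-! ### §3 Pointwise faithfulness of the holomorphic image -/

section Pointwise

variable {E : Type} [NormedAddCommGroup E] [NormedSpace ℂ E] [FiniteDimensional ℂ E] {m : ℕ}
  {Y : Motives.SchemeOver ℂ} {N : ℕ}

/-- The coordinate form `dT_J` is the polynomial wedge `d(T_{J 0}) ∧ ⋯ ∧ d(T_{J (p-1)})` (both are
defined by the same right-bracketed recursion; private helper). [folklore] -/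
private theorem dXs_eq_polyWedge : ∀ (p : ℕ) (J : Fin p → Fin N),
    (dXs p J : PolyForm ℂ N p) = polyWedge p (fun i ↦ X (J i))
  | 0, _ => rfl
  | p + 1, J => by
    rw [dXs_succ, polyWedge, dXs_eq_polyWedge p (Fin.tail J)]
    rfl

variable [IsAffine Y.left] (A : AnalyticModel E m Y) (x : Fin N → Γ(Y.left, ⊤))

/-- **The holomorphic image of the coordinate form `dT_J` is `dx_J^an`** (`coordWedge`).
[cite: Grothendieck1966, (5)] -/
theorem polyFormRealize_dXs (p : ℕ) (J : Fin p → Fin N) :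
    polyFormRealize A x p (dXs p J) = coordWedge A x p J := by
  rw [dXs_eq_polyWedge, polyFormRealize_polyWedge]
  simp only [coordPresentation_X]

open Set.powersetCard in
/-- **The holomorphic image of a polynomial form in the coordinate frame, at a point**:
`α^an(z) = Σ_J (φ_x α(e_J))^an(z) · (dx_{J 0}^an)_z ∧ ⋯ ∧ (dx_{J (p-1)}^an)_z`, the sum over the
increasing `J` (decomposition `α = Σ_J α(e_J) dT_J`, `ℂ[T]`-semilinearity and `(dT_J)^an = dx_J^an`).
[cite: Grothendieck1966, (5)] -/
theorem polyFormRealize_apply_eq_sum_iterWedge (p : ℕ) (α : PolyForm ℂ N p) (z : A.carrier) :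
    polyFormRealize A x p α z = ∑ s : Set.powersetCard (Fin N) p,
      A.regularFun (coordPresentation Y x (α fun a ↦ Pi.single (ofFinEmbEquiv.symm s a) 1)) z •
        ContinuousAlternatingMap.iterWedge p
          (fun a ↦ A.dAt (A.regularFun (x (ofFinEmbEquiv.symm s a))) z) := by
  conv_lhs => rw [PolyForm.eq_sum_smul_dXs α]
  rw [map_sum, Finset.sum_apply]
  refine Finset.sum_congr rfl fun s _ ↦ ?_
  rw [polyFormRealize_smul]
  dsimp only
  rw [polyFormRealize_dXs, coordWedge_apply]
  rfl

open Set.powersetCard in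
/-- **Pointwise faithfulness of the holomorphic image.** If at `z ∈ Y^an` the differentials
`(dx_0^an)_z, …, (dx_{N-1}^an)_z` of ALL the coordinates admit dual tangent vectors `u_b`
(`(dx_a^an)_z(u_b) = δ_{ab}`), then a polynomial `p`-form `α` whose holomorphic image vanishes at `z`
has all its coefficients vanishing there: `(φ_x α(e_J))^an(z) = 0` for every increasing `J` (the
iterated wedges of a dual family are linearly independent,
`ContinuousAlternatingMap.linearIndependent_iterWedge_of_dual`). This is the injectivity of
algebraic into analytic differential forms [SerreGAGA1956, §2 n°6 Prop. 3 Cor. 2], read at one point,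
on the `PolyForm` carrier. [cite: SerreGAGA1956, §2 n°6 Prop. 3 Cor. 2] -/
theorem regularFun_coeff_eq_zero_of_polyFormRealize_apply_eq_zero {p : ℕ} (α : PolyForm ℂ N p)
    {z : A.carrier} (u : Fin N → E)
    (hdual : ∀ a b, A.dAt (A.regularFun (x a)) z ![u b] = if a = b then 1 else 0)
    (h : polyFormRealize A x p α z = 0) (s : Set.powersetCard (Fin N) p) :
    A.regularFun (coordPresentation Y x (α fun a ↦ Pi.single (ofFinEmbEquiv.symm s a) 1)) z = 0 := by
  rw [polyFormRealize_apply_eq_sum_iterWedge] at h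
  have hli := ContinuousAlternatingMap.linearIndependent_iterWedge_of_dual
    (fun a ↦ A.dAt (A.regularFun (x a)) z) u hdual p
  exact (Fintype.linearIndependent_iff.1 hli) _ h s

end Pointwise

/-! ### §4 The Poincaré lemma for the model space -/

section ModelSpace

variable {E : Type*} [NormedAddCommGroup E] [NormedSpace ℂ E] [FiniteDimensional ℂ E]

omit [FiniteDimensional ℂ E] in
/-- Exactness on an open set only depends on the set (transport of the membership along an
equality of sets; the `IsOpen` proofs differ; private helper). [folklore] -/
private theorem mem_localExactForms_congr_set {M : Type*} [TopologicalSpace M] [ChartedSpace E M]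
    [IsManifold 𝓘(ℝ, E) ∞ M] {k : ℕ} {S T : Set M} (e : S = T) (hS : IsOpen S) (hT : IsOpen T)
    {α : MForm 𝓘(ℝ, E) M ℂ k} (h : α ∈ localExactForms 𝓘(ℝ, E) ℂ hS k) :
    α ∈ localExactForms 𝓘(ℝ, E) ℂ hT k := by
  subst e
  exact h

variable (E) in
/-- **Poincaré lemma for the model space: `H^{k+1}_dR(E; ℂ) = 0`** for a finite-dimensional complex
normed space `E`, as a manifold charted on itself. A closed smooth complex `(k+1)`-form on `E` is
closed on the chart set `univ` of the (identity) chart, hence exact there by the cone operator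
(`localClosedForms_chartSet_le_localExactForms`, Lee Thm. 17.14), hence `d` of a smooth complex
`k`-form. [cite: LeeSmoothManifolds2013, Thm. 17.14] -/
theorem subsingleton_complexDeRhamCohomology_modelSpace_succ (k : ℕ) :
    Subsingleton (complexDeRhamCohomology E E (k + 1)) := by
  refine subsingleton_of_forall_eq 0 fun c ↦ ?_
  obtain ⟨α, rfl⟩ := complexDeRhamCohomology.mk_surjective c
  rw [← map_zero (complexDeRhamCohomology.mk E E (k + 1)), complexDeRhamCohomology.mk_eq_mk_iff,
    Submodule.coe_zero, sub_zero]
  obtain ⟨hs, hc⟩ := (mem_cclosedSmoothForms_iff (α : MForm 𝓘(ℝ, E) E ℂ (k + 1))).1 α.2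
  -- closed on the chart set `univ` of the identity chart at `0`
  have hloc : (α : MForm 𝓘(ℝ, E) E ℂ (k + 1)) ∈
      localClosedForms 𝓘(ℝ, E) ℂ (k + 1) (chartSet 𝓘(ℝ, E) (0 : E) (univ : Set E)) := by
    rw [chartSet_model_space]
    exact mem_localClosedForms_univ_of_mem_closedSmoothForms ⟨hs, hc⟩
  have hWT : (univ : Set E) ⊆ (extChartAt 𝓘(ℝ, E) (0 : E)).target := by
    rw [extChartAt_model_space_eq_id, PartialEquiv.refl_target]
  -- exact there (Poincaré lemma on a chart-convex set), hence exact on `univ`, hence globally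
  have hex := localClosedForms_chartSet_le_localExactForms (I := 𝓘(ℝ, E)) (F := ℂ) (0 : E)
    isOpen_univ convex_univ hWT hloc
  have hex' : (α : MForm 𝓘(ℝ, E) E ℂ (k + 1)) ∈ exactSmoothForms 𝓘(ℝ, E) E ℂ (k + 1) :=
    mem_exactSmoothForms_of_mem_localExactForms_univ
      (mem_localExactForms_congr_set (chartSet_model_space (0 : E) univ) _ isOpen_univ hex)
  rw [← Submodule.restrictScalars_mem ℝ, restrictScalars_cexactSmoothForms_holds]
  exact hex'

end ModelSpace

/-! ### §5 The standard analytic model of affine space -/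

section AffineSpace

variable (m : ℕ)

/-- `𝔸^m_k → Spec k` is smooth of relative dimension `m` (the tree's PROVED
`smoothOfRelativeDimension_affineSpace_holds`, with `Nat.card (Fin m) = m`), as an instance for the
binder `[SmoothOfRelativeDimension m Y.hom]` of the comparison files.
[cite: Hartshorne1977, III §10 Example 10.0.3] -/
instance smoothOfRelativeDimension_affineSpaceOver_fin_hom (k : Type) [Field k] :
    SmoothOfRelativeDimension m (affineSpaceOver (Fin m) k).hom := by
  have h := smoothOfRelativeDimension_affineSpace_holds (Fin m) k
  rwa [Nat.card_eq_fintype_card, Fintype.card_fin] at h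

/-- `𝔸^σ_k` is an affine scheme (Mathlib's instance for `𝔸(n; S)`, `S` affine, restated because
instance search does not unfold `(Over.mk f).left`). [cite: Hartshorne1977, II Example 2.3.3] -/
instance isAffine_affineSpaceOver_left (σ : Type u) (k : Type u) [Field k] :
    IsAffine (affineSpaceOver σ k).left :=
  inferInstanceAs <| IsAffine 𝔸(σ; Spec (.of k))

/-- `𝔸^σ_k` is irreducible, hence connected (Mathlib's instance for `𝔸(n; S)`, `S` irreducible,
restated for `(Over.mk f).left`). [cite: Hartshorne1977, II Example 2.3.3] -/
instance irreducibleSpace_affineSpaceOver_left (σ : Type u) (k : Type u) [Field k] :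
    IrreducibleSpace (affineSpaceOver σ k).left :=
  inferInstanceAs <| IrreducibleSpace 𝔸(σ; Spec (.of k))

/-- `𝔸^σ_k` is reduced (Mathlib's instance for `𝔸(n; S)`, `S` reduced, restated for
`(Over.mk f).left`). [cite: Hartshorne1977, II Example 2.3.3] -/
instance isReduced_affineSpaceOver_left (σ : Type u) (k : Type u) [Field k] :
    IsReduced (affineSpaceOver σ k).left :=
  inferInstanceAs <| IsReduced 𝔸(σ; Spec (.of k))

/-- **The standard analytic model of affine space**: `ℂ^m` with its trivial atlas and the chart
`w ↦` (the complex point with coordinates `w`) is the analytification of `𝔸^m_ℂ` — Serre, GAGA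
§2 n°5 Lemme 1 and Prop. 2 («un polynôme est une fonction holomorphe»); the proof is the tree's
`exists_isAnalytification_affineSpace_holds` (`ComplexPoints.affineHomeomorph`,
`ComplexPoints.differentiableOn_evalOrZero_affinePoint`), here BUNDLED as an `AnalyticModel` so
that the comparison map of `𝔸^m` can be evaluated on it. [cite: SerreGAGA1956, §2 n°5 Lemme 1 & Prop. 2] -/
def AnalyticModel.affineSpace : AnalyticModel (Fin m → ℂ) m (affineSpaceOver (Fin m) ℂ) where
  carrier := Fin m → ℂ
  toComplexPoints := Motives.AlgPoints.affinePoint ℂ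
  isAnalytification :=
    ⟨(Motives.ComplexPoints.affineHomeomorph m).isHomeomorph, Module.finrank_fin_fun ℂ,
      fun U s ↦ mdifferentiableOn_iff_differentiableOn.mpr
        (Motives.ComplexPoints.differentiableOn_evalOrZero_affinePoint m U.1 s)⟩

/-- The coordinate sections `T₀, …, T_{m-1} ∈ Γ(𝔸^m_ℂ, 𝒪)` (Mathlib `AffineSpace.coord`).
[cite: Hartshorne1977, II Example 2.3.3] -/
def affineSpaceCoord : Fin m → Γ((affineSpaceOver (Fin m) ℂ).left, ⊤) :=
  fun i ↦ AffineSpace.coord (Spec (.of ℂ)) i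

namespace AnalyticModel

/-- The comparison map of the standard model is `w ↦ affinePoint ℂ w` (definitional).
[cite: SerreGAGA1956, §2 n°5] -/
theorem affineSpace_toComplexPoints (w : Fin m → ℂ) :
    (affineSpace m).toComplexPoints w = Motives.AlgPoints.affinePoint ℂ w :=
  rfl

/-- **A global function on `𝔸^m_ℂ` read on `ℂ^m` is polynomial evaluation**:
`s^an(w) = s(w)` with `s ∈ Γ(𝔸^m, 𝒪) ≅ ℂ[T]` (`affineSpaceGlobalSectionsIso`).
[cite: SerreGAGA1956, §2 n°5 Lemme 1] -/
theorem affineSpace_regularFun_apply (s : Γ((affineSpaceOver (Fin m) ℂ).left, ⊤)) (w : Fin m → ℂ) :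
    (affineSpace m).regularFun s w =
      MvPolynomial.eval w ((affineSpaceGlobalSectionsIso (Fin m) (.of ℂ)).hom s) := by
  change Motives.AlgPoints.evalOrZero ⊤ s (Motives.AlgPoints.affinePoint ℂ w) = _
  rw [Motives.AlgPoints.evalOrZero_of_mem _ (TopologicalSpace.Opens.mem_top _)]
  exact Motives.ComplexPoints.eval_top_affinePoint m w s

/-- The coordinate `Tᵢ` read on `ℂ^m` is the `i`-th projection: `Tᵢ^an(w) = wᵢ`.
[cite: SerreGAGA1956, §2 n°5] -/
theorem affineSpace_regularFun_coord (i : Fin m) :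
    (affineSpace m).regularFun (affineSpaceCoord m i) = fun w ↦ w i := by
  funext w
  exact Motives.AlgPoints.evalOrZero_coord_affinePoint w i

/-- **`(φ_T f)^an = f` as a function on `ℂ^m`**: a polynomial in the coordinates, read on the
standard model, is the polynomial function. [cite: SerreGAGA1956, §2 n°5 Lemme 1] -/
theorem affineSpace_regularFun_coordPresentation (f : MvPolynomial (Fin m) ℂ) :
    (affineSpace m).regularFun (coordPresentation (affineSpaceOver (Fin m) ℂ) (affineSpaceCoord m) f) =
      fun w ↦ MvPolynomial.eval w f := by
  funext w
  rw [regularFun_coordPresentation]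
  simp only [affineSpace_regularFun_coord]

end AnalyticModel

/-- **`φ_T : ℂ[T] → Γ(𝔸^m_ℂ, 𝒪)` is injective**: a polynomial whose image vanishes is zero as a
function on `ℂ^m` (read it on the standard model), hence zero (`MvPolynomial.funext`, `ℂ` infinite).
[cite: Hartshorne1977, II Prop. 2.2] -/
theorem coordPresentation_affineSpaceCoord_injective :
    Function.Injective (coordPresentation (affineSpaceOver (Fin m) ℂ) (affineSpaceCoord m)) := by
  refine (injective_iff_map_eq_zero _).2 fun f hf ↦ ?_
  apply MvPolynomial.funext
  intro w
  have h := congrFun (AnalyticModel.affineSpace_regularFun_coordPresentation m f) w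
  rw [hf, AnalyticModel.regularFun_zero] at h
  rw [map_zero]
  exact h.symm

/-- `ker φ_T = 0` for the coordinates of `𝔸^m_ℂ`: `𝔸^m = V(0) ⊆ 𝔸^m`. [cite: Hartshorne1977, II Prop. 2.2] -/
theorem ker_coordPresentation_affineSpaceCoord :
    RingHom.ker (coordPresentation (affineSpaceOver (Fin m) ℂ) (affineSpaceCoord m)) = ⊥ :=
  (RingHom.injective_iff_ker_eq_bot _).1 (coordPresentation_affineSpaceCoord_injective m)

/-- **`φ_T : ℂ[T] → Γ(𝔸^m_ℂ, 𝒪)` is surjective**: `s` is the image of the polynomial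
`p = (Γ(𝔸^m, 𝒪) ≅ ℂ[T])(s)`, because `(φ_T p)^an = p = s^an` on `ℂ^m` and a regular function on
the reduced `𝔸^m` is determined by its values at complex points
(`AnalyticModel.regularFun_eq_zero_iff`). [cite: Hartshorne1977, II Prop. 2.2] -/
theorem coordPresentation_affineSpaceCoord_surjective :
    Function.Surjective (coordPresentation (affineSpaceOver (Fin m) ℂ) (affineSpaceCoord m)) := by
  intro s
  refine ⟨(affineSpaceGlobalSectionsIso (Fin m) (.of ℂ)).hom s, ?_⟩
  rw [← sub_eq_zero, ← (AnalyticModel.affineSpace m).regularFun_eq_zero_iff]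
  funext w
  rw [← AnalyticModel.regularFunRingHom_apply, map_sub, Pi.sub_apply,
    AnalyticModel.regularFunRingHom_apply, AnalyticModel.regularFunRingHom_apply,
    AnalyticModel.affineSpace_regularFun_coordPresentation,
    AnalyticModel.affineSpace_regularFun_apply, sub_self, Pi.zero_apply]

/-- `φ_T` is bijective: the coordinates `T` present `Γ(𝔸^m_ℂ, 𝒪) = ℂ[T]` with no relations.
[cite: Hartshorne1977, II Prop. 2.2] -/
theorem coordPresentation_affineSpaceCoord_bijective :
    Function.Bijective (coordPresentation (affineSpaceOver (Fin m) ℂ) (affineSpaceCoord m)) :=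
  ⟨coordPresentation_affineSpaceCoord_injective m, coordPresentation_affineSpaceCoord_surjective m⟩

/-! ### §6 Theorem 1′ for affine space -/

/-- On the standard model the coordinate differentials are the coordinate projections, so the
standard basis vectors are dual to them: `(dT_a^an)_w(e_b) = δ_{ab}`. [cite: Warner1983, 2.22] -/
theorem affineSpace_dAt_coord_single (w : Fin m → ℂ) (a b : Fin m) :
    (AnalyticModel.affineSpace m).dAt ((AnalyticModel.affineSpace m).regularFun (affineSpaceCoord m a))
      w ![(Pi.single b 1 : Fin m → ℂ)] = if a = b then 1 else 0 := by
  rw [AnalyticModel.affineSpace_regularFun_coord]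
  change (mextDeriv (MForm.ofFun 𝓘(ℝ, Fin m → ℂ) fun v : Fin m → ℂ ↦ v a) w :
      (Fin m → ℂ) [⋀^Fin 1]→L[ℝ] ℂ) ![(Pi.single b 1 : Fin m → ℂ)] = _
  rw [mextDeriv_ofFun_apply_single, extChartAt_model_space_eq_id, PartialEquiv.refl_symm,
    PartialEquiv.refl_coe, Function.comp_id, id_eq,
    (hasFDerivAt_apply (𝕜 := ℝ) a w).fderiv, ContinuousLinearMap.proj_apply, Pi.single_apply]

/-- **The holomorphic image of polynomial forms on `𝔸^m_ℂ` is faithful** (standard model): a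
polynomial `p`-form `α` with `α^an = 0` on `ℂ^m` is `0` — every coefficient `α(e_J)`, `J`
increasing, vanishes at every point of `ℂ^m` (§3 with the dual basis vectors), hence is the zero
polynomial, and `α` is determined by these coefficients. [cite: SerreGAGA1956, §2 n°6 Prop. 3 Cor. 2] -/
theorem polyFormRealize_affineSpace_injective (p : ℕ) :
    Function.Injective (polyFormRealize (AnalyticModel.affineSpace m) (affineSpaceCoord m) p) := by
  refine (injective_iff_map_eq_zero _).2 fun α hα ↦ ?_
  refine AlternatingMap.ext_of_basis_powersetCard (Pi.basisFun ℤ (Fin m)) fun s ↦ ?_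
  rw [AlternatingMap.zero_apply]
  simp only [Pi.basisFun_apply]
  refine MvPolynomial.funext fun w ↦ ?_
  rw [map_zero]
  have h := regularFun_coeff_eq_zero_of_polyFormRealize_apply_eq_zero (AnalyticModel.affineSpace m)
    (affineSpaceCoord m) α (z := w) (fun b ↦ (Pi.single b 1 : Fin m → ℂ))
    (affineSpace_dAt_coord_single m w) (by rw [hα]; rfl) s
  rw [AnalyticModel.affineSpace_regularFun_coordPresentation] at h
  exact h

/-- **The holomorphic image of regular forms on `𝔸^m_ℂ` is faithful** (standard model, every
degree, any `I ⊆ ker φ_T = 0`). [cite: SerreGAGA1956, §2 n°6 Prop. 3 Cor. 2] -/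
theorem regularFormRealize_affineSpace_std_injective (p : ℕ) {I : Ideal (MvPolynomial (Fin m) ℂ)}
    (hI : I ≤ RingHom.ker (coordPresentation (affineSpaceOver (Fin m) ℂ) (affineSpaceCoord m))) :
    Function.Injective (regularFormRealize (AnalyticModel.affineSpace m) (affineSpaceCoord m) hI p) := by
  refine (injective_iff_map_eq_zero _).2 fun r hr ↦ ?_
  obtain ⟨α, rfl⟩ := RegularForm.mk_surjective I r
  rw [regularFormRealize_mk] at hr
  rw [(injective_iff_map_eq_zero _).1 (polyFormRealize_affineSpace_injective m p) α hr, map_zero]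

/-- **Grothendieck's Theorem 1′ for affine space, on the standard model**: the comparison map
`H^k(Γ(𝔸^m, Ω•)) → H^k_dR(ℂ^m; ℂ)` along the coordinates `T` is bijective in every degree `k`
[Grothendieck1966, p. 96 Thm 1′: "The homomorphism (5) is an isomorphism"]. Degree `0`:
`deRhamComparison_bijective_degree_zero` (`𝔸^m` is smooth and connected). Degree `k + 1`: the
source `H^{k+1}_dR(𝔸^m/ℂ)` vanishes [Hartshorne1975, Ch. II §7 p. 53]
(`subsingleton_deRhamCohomology_bot_succ`, transported along `ker φ_T = 0`) and so does the target
`H^{k+1}_dR(ℂ^m; ℂ)` (Poincaré lemma, §4). [cite: Grothendieck1966, Thm 1']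
[cite: Hartshorne1975, Ch. II §7 p. 53] -/
theorem deRhamComparison_affineSpace_std_bijective (k : ℕ) :
    Function.Bijective (deRhamComparison (AnalyticModel.affineSpace m) (affineSpaceCoord m)
      (le_refl (RingHom.ker (coordPresentation (affineSpaceOver (Fin m) ℂ) (affineSpaceCoord m)))) k) := by
  cases k with
  | zero => exact deRhamComparison_bijective_degree_zero (AnalyticModel.affineSpace m) (affineSpaceCoord m)
  | succ k =>
    haveI hsrc : Subsingleton (DeRhamCohomology
        (RingHom.ker (coordPresentation (affineSpaceOver (Fin m) ℂ) (affineSpaceCoord m))) (k + 1)) := by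
      rw [ker_coordPresentation_affineSpaceCoord]
      exact subsingleton_deRhamCohomology_bot_succ ℂ m k
    haveI htgt : Subsingleton
        (complexDeRhamCohomology (Fin m → ℂ) (AnalyticModel.affineSpace m).carrier (k + 1)) :=
      subsingleton_complexDeRhamCohomology_modelSpace_succ (Fin m → ℂ) k
    exact ⟨Function.injective_of_subsingleton _, fun c ↦ ⟨0, Subsingleton.elim _ _⟩⟩

variable {E : Type} [NormedAddCommGroup E] [NormedSpace ℂ E] [FiniteDimensional ℂ E]

/-- **Faithfulness of the holomorphic image of regular forms on `𝔸^m_ℂ`, for EVERY analytic model**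
(model independence, §2). [cite: SerreGAGA1956, §2 n°6 Prop. 3 Cor. 2] [cite: SerreGAGA1956, §2 n°5] -/
theorem regularFormRealize_affineSpace_injective (A : AnalyticModel E m (affineSpaceOver (Fin m) ℂ))
    (p : ℕ) {I : Ideal (MvPolynomial (Fin m) ℂ)}
    (hI : I ≤ RingHom.ker (coordPresentation (affineSpaceOver (Fin m) ℂ) (affineSpaceCoord m))) :
    Function.Injective (regularFormRealize A (affineSpaceCoord m) hI p) :=
  regularFormRealize_injective_of_model A (AnalyticModel.affineSpace m) (affineSpaceCoord m) hI p
    (regularFormRealize_affineSpace_std_injective m p hI)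

/-- **Grothendieck's Theorem 1′ for affine space** [Grothendieck1966, p. 96: "The homomorphism (5)
is an isomorphism"]: for every analytic model `A` of `𝔸^m_ℂ` (on any model space) and every degree
`k`, the comparison map `H^k(Γ(𝔸^m, Ω•)) → H^k_dR(A; ℂ)` along the coordinates `T` is bijective
(the standard model, `deRhamComparison_affineSpace_std_bijective`, and model independence, §2).
[cite: Grothendieck1966, Thm 1'] [cite: Hartshorne1975, Ch. II §7 p. 53] -/
theorem deRhamComparison_affineSpace_bijective (A : AnalyticModel E m (affineSpaceOver (Fin m) ℂ))
    (k : ℕ) :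
    Function.Bijective (deRhamComparison A (affineSpaceCoord m)
      (le_refl (RingHom.ker (coordPresentation (affineSpaceOver (Fin m) ℂ) (affineSpaceCoord m)))) k) :=
  deRhamComparison_bijective_of_model A (AnalyticModel.affineSpace m) (affineSpaceCoord m) _ k
    (deRhamComparison_affineSpace_std_bijective m k)

/-- **`H^{k+1}_dR((𝔸^m)^an; ℂ) = 0` for every analytic model of affine space** (§4 on the standard
model, transported by §2). [cite: LeeSmoothManifolds2013, Thm. 17.14] [cite: SerreGAGA1956, §2 n°5] -/
theorem subsingleton_complexDeRhamCohomology_affineSpace_succ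
    (A : AnalyticModel E m (affineSpaceOver (Fin m) ℂ)) (k : ℕ) :
    Subsingleton (complexDeRhamCohomology E A.carrier (k + 1)) :=
  haveI : Subsingleton
      (complexDeRhamCohomology (Fin m → ℂ) (AnalyticModel.affineSpace m).carrier (k + 1)) :=
    subsingleton_complexDeRhamCohomology_modelSpace_succ (Fin m → ℂ) k
  A.subsingleton_complexDeRhamCohomology_of_model (AnalyticModel.affineSpace m) (k + 1)

/-- **The `(hcmp)` clause of `chartConjugation_canonical_of_deRhamComparison` for `Y = 𝔸^m_ℂ`**,
verbatim: for every analytic model `A` of `𝔸^m_ℂ` and every degree `k` there are coordinates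
(`T₀, …, T_{m-1}`) generating `Γ(𝔸^m, 𝒪)` such that the holomorphic image of regular
`(k+1)`-forms on `V(ker φ_T)` is faithful and Grothendieck's comparison map (5) is bijective in
degree `k`. [cite: Grothendieck1966, Thm 1'] [cite: SerreGAGA1956, §2 n°6 Prop. 3 Cor. 2] -/
theorem hcmp_affineSpace (m : ℕ) (E : Type) [NormedAddCommGroup E] [NormedSpace ℂ E]
    [FiniteDimensional ℂ E] (A : AnalyticModel E m (affineSpaceOver (Fin m) ℂ)) (k : ℕ) :
    ∃ (N : ℕ) (x : Fin N → Γ((affineSpaceOver (Fin m) ℂ).left, ⊤)),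
      Function.Surjective (coordPresentation (affineSpaceOver (Fin m) ℂ) x) ∧
      Function.Injective (regularFormRealize A x
        (le_refl (RingHom.ker (coordPresentation (affineSpaceOver (Fin m) ℂ) x))) (k + 1)) ∧
      Function.Bijective (deRhamComparison A x
        (le_refl (RingHom.ker (coordPresentation (affineSpaceOver (Fin m) ℂ) x))) k) :=
  ⟨m, affineSpaceCoord m, coordPresentation_affineSpaceCoord_surjective m,
    regularFormRealize_affineSpace_injective m A (k + 1) le_rfl,
    deRhamComparison_affineSpace_bijective m A k⟩

/-- **(G) for affine space**: every complex de Rham class of any analytic model of `𝔸^m_ℂ`, in any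
degree, is the class of the realisation of an algebraic form expression — the conclusion of the
named fact `grothendieck_comparison_realize_surjective` for `Y = 𝔸^m`
(`exists_realize_eq_of_deRhamComparison_surjective` and Theorem 1′ for affine space).
[cite: Grothendieck1966, Thm 1'] -/
theorem exists_realize_eq_affineSpace (A : AnalyticModel E m (affineSpaceOver (Fin m) ℂ)) (p : ℕ)
    (c : complexDeRhamCohomology E A.carrier p) :
    ∃ (ξ : AlgFormExpr (affineSpaceOver (Fin m) ℂ) p)
      (hξ : ξ.realize A ∈ cclosedSmoothForms E A.carrier p),
      complexDeRhamCohomology.mk E A.carrier p ⟨ξ.realize A, hξ⟩ = c :=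
  exists_realize_eq_of_deRhamComparison_surjective A (affineSpaceCoord m) le_rfl
    (deRhamComparison_affineSpace_bijective m A p).2 c

end AffineSpace

end HodgeTheory

end Literature.AlgebraicGeometry.HodgeTheory

end
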